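import Literature.NumberTheory.BeurlingPrimes.LiStieltjes
import Literature.NumberTheory.BeurlingPrimes.BVRiemannCount
import Literature.NumberTheory.BeurlingPrimes.BVPerron
import Literature.NumberTheory.BeurlingPrimes.BVPrimeSurgery
import Literature.NumberTheory.BeurlingPrimes.ErrorExponents
import Literature.Barriers.RiemannHypothesis.BeurlingCounterexamplesHilberdinkProofs
import HarnessLib

/-!
# Broucke–Vindas 2024, Theorem 3.1 (the `[0, 1/2]`-system) from Theorem 1.2 — proof

Sibling proofs file of `Literature/NumberTheory/BeurlingPrimes/WellBehavedSystems.lean` for the named fact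
`BrouckeVindas2024_thm31` ("There is a discrete Beurling generalized prime system `𝒫` such that
`Π_𝒫(x) = Li(x) + O(log log x)`, `N_𝒫(x) = x + O(x^{1/2} exp(c(log x)^{2/3}))` for some `c > 0`, and
`N_𝒫(x) = x + Ω_ε(x^{1/2−ε})` for any `ε > 0`", F. Broucke, J. Vindas, Math. Z. 307 (2024), Theorem 3.1), reduced to
the random approximation theorem `BrouckeVindas2024_thm12` (BV Theorem 1.2, the only input of the printed proof
that is not formalised here) — `BrouckeVindas2024_thm31_of_thm12` — following the printed proof (§3) verbatim:

1. Theorem 1.2 applied to `F = li` (`LiStieltjes.lean`: `li` as a Stieltjes function, `dli = li′ du`, the hypotheses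
   of Theorem 1.2) gives `𝒫₀` with `|π − li| ≤ 2` and (1.3), i.e. `BV.Approx liDens 𝒫₀ A` (`BVContinuation.lean`).
2. `Z(s) = log ζ_𝒫(s) − log(s/(s−1))` continues to `σ > 1/2` with the bound (3.2) — `BV.Z liDens poleDensity`
   (`BVContinuation.lean`, with `exp ∫₁^∞ Li′(u)u^{−s} du = s/(s−1)` from the tree's DMV (32)).
3. "By changing a finite number of primes, we may assume that `Z(1) = 0`": `Σ 1/p_j = ∞` (from step 2 at real
   `σ ↓ 1`), then `BVPrimeSurgery.lean` realises the shift `−Re Z(1)`; the new residue `e^{Z(1)}` has modulus `1` and is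
   a positive real, hence equals `1`.
4. Perron inversion on `σ_x = 1/2 + (log x)^{−1/3}` (`BVPerron.lean`): `N(x) = x + O(x^{1/2} exp(c (log x)^{2/3}))`.
5. `Π = Li + O(log log x)` from `π = li + O(1)` (`BVRiemannCount.lean`).
6. The `Ω`-clause "follows at once from (3.3) and the result of Hilberdink and Neamah": here from Hilberdink 2005,
   Theorem 1 (`Hilberdink2005_thm1_holds`, PROVED in the tree) via `LiAbel.lean`/`ErrorExponents.lean`
   (the primes are `0`-well-behaved, so `N(x) − x ≪ x^{1/2−ε}` is impossible).

## References
* [BrouckeVindas2024] F. Broucke, J. Vindas, *A new generalized prime random approximation procedure and some of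
  its applications*, Math. Z. 307 (2024), arXiv:2102.08478, Theorems 1.2, 3.1 and the proof of Theorem 3.1 (read).
* [Hilberdink2005] T. W. Hilberdink, *Well-behaved Beurling primes and integers*, J. Number Theory 112 (2005),
  Theorem 1.
-/

noncomputable section

open Complex Set Filter MeasureTheory Real
open scoped Topology

namespace Literature.NumberTheory.BeurlingPrimes

open Literature.Barriers.RiemannHypothesis

namespace BV

/-! ### Step 1–2: the hypotheses of the Perron step for the template pair `(li′, Li′)` -/

/-- `exp(∫₁^∞ Li′(u) u^{−s} du) = s/(s−1)` for `σ > 1` (DMV (32): `∫₁^∞ (1−1/v)/log v · v^{−s} dv = log(s/(s−1))`).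
[cite: BrouckeVindas2024, proof of Theorem 3.1] -/
theorem exp_integral_poleDensity {s : ℂ} (hs : 1 < s.re) :
    Complex.exp (∫ u in Ioi (1 : ℝ), (DMV.poleDensity u : ℂ) * (u : ℂ) ^ (-s)) = s / (s - 1) := by
  rw [← DMV.log_div_sub_one_eq_integral hs, Complex.exp_log]
  have hs0 : s ≠ 0 := fun h ↦ by rw [h] at hs; simp at hs; linarith
  have hs1 : s - 1 ≠ 0 := fun h ↦ by
    have : s = 1 := sub_eq_zero.mp h
    rw [this] at hs; simp at hs
  exact div_ne_zero hs0 hs1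

/-- **The hypotheses `PerronHyp` hold for `f = liDens`, `g = poleDensity`, `K = 1`** and any system with (1.3).
[cite: BrouckeVindas2024, proof of Theorem 3.1] -/
theorem perronHyp_li {P : BeurlingPrimes} {A : ℝ} (hA : Approx liDens P A) :
    PerronHyp liDens DMV.poleDensity P A 1 where
  approx := hA
  fm := measurable_liDens
  fb := abs_liDens_le_two
  gm := measurable_poleDensity
  gf := fun _ hu ↦ poleDensity_sub_liDens hu
  g1 := fun _ hs ↦ exp_integral_poleDensity hs

/-! ### Step 3a: `Σ_j 1/λ_j = ∞` under `PerronHyp` -/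

variable {f g : ℝ → ℝ} {P : BeurlingPrimes} {A K : ℝ}

/-- For real `1 < σ ≤ 2`: `Σ_j λ_j^{−σ} ≥ log(σ/(σ−1)) − 4A − 2K` (from `Σ_j λ_j^{−s} = ∫₁^∞ g u^{−s} + E₂ − E₃` and
the bounds on `E₂`, `E₃`). [cite: BrouckeVindas2024, proof of Theorem 3.1] -/
theorem PerronHyp.log_le_tsum_prime_rpow (h : PerronHyp f g P A K) {σ : ℝ} (hσ1 : 1 < σ) (hσ2 : σ ≤ 2) :
    Real.log (σ / (σ - 1)) - 4 * A - 2 * K ≤ ∑' j, P.prime j ^ (-σ) := by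
  have hs : 1 < ((σ : ℂ)).re := by simpa using hσ1
  have hs' : 1 / 2 < ((σ : ℂ)).re := by simp; linarith
  -- the complex identity `Σ' λ_j^{-σ} = E₂ + ∫ g u^{-σ} − E₃`
  have hE₂ := E₂_eq h.approx h.fm h.fb hs
  obtain ⟨-, hfg⟩ := integral_f_cpow_eq h.fm h.fb h.gm h.gf hs
  set T : ℂ := ∑' j, ((P.prime j : ℝ) : ℂ) ^ (-(σ : ℂ)) with hT
  set G : ℂ := ∫ u in Ioi (1 : ℝ), (g u : ℂ) * (u : ℂ) ^ (-(σ : ℂ)) with hG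
  have hid : T = E₂ f P σ + G - E₃ f g σ := by rw [hE₂, hfg]; ring
  -- `T` is the real sum
  have hsum : Summable fun j ↦ P.prime j ^ (-σ) := h.approx.summable_prime_rpow_neg h.fb hσ1
  have hTre : T = ((∑' j, P.prime j ^ (-σ) : ℝ) : ℂ) := by
    rw [hT, Complex.ofReal_tsum]
    refine tsum_congr fun j ↦ ?_
    rw [Complex.ofReal_cpow (P.prime_pos j).le]
    simp only [Complex.ofReal_neg]
  -- `Re G = log(σ/(σ−1))` from `exp G = σ/(σ−1)`
  have hGre : G.re = Real.log (σ / (σ - 1)) := by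
    have h1 := h.g1 (σ : ℂ) hs
    have h2 := congrArg norm h1
    rw [Complex.norm_exp] at h2
    have h3 : ‖(σ : ℂ) / ((σ : ℂ) - 1)‖ = σ / (σ - 1) := by
      have : (σ : ℂ) / ((σ : ℂ) - 1) = ((σ / (σ - 1) : ℝ) : ℂ) := by push_cast; ring
      rw [this, Complex.norm_real, Real.norm_eq_abs, abs_of_pos (div_pos (by linarith) (by linarith))]
    rw [h3] at h2
    rw [← h2, Real.log_exp]
  -- bounds on `E₂`, `E₃` at `s = σ`
  have hA0 := h.approx.nonneg
  have hK0 := cmpConst_nonneg h.gf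
  have hE₂b : ‖E₂ f P σ‖ ≤ 4 * A := by
    have hb := norm_E₂_le h.approx h.fm h.fb hs'
    simp only [Complex.ofReal_re, Complex.ofReal_im, abs_zero, zero_add, Real.log_one, Real.sqrt_zero,
      mul_zero, zero_div, add_zero] at hb
    refine hb.trans ?_
    have h1 : 1 / (σ - 1 / 2) ≤ 2 := by rw [div_le_iff₀ (by linarith)]; linarith
    calc σ * (A * (1 / (σ - 1 / 2))) ≤ 2 * (A * 2) :=
          mul_le_mul hσ2 (mul_le_mul_of_nonneg_left h1 hA0) (by positivity) (by norm_num)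
      _ = 4 * A := by ring
  have hE₃b : ‖E₃ f g σ‖ ≤ 2 * K := by
    have hb := norm_E₃_le h.fm h.gm h.gf hs'
    simp only [Complex.ofReal_re] at hb
    refine hb.trans ?_
    rw [div_le_iff₀ (by linarith)]; nlinarith
  -- take real parts
  have hre := congrArg Complex.re hid
  rw [hTre, Complex.ofReal_re, sub_re, add_re, hGre] at hre
  rw [hre]
  linarith [abs_le.mp ((Complex.abs_re_le_norm (E₂ f P σ)).trans hE₂b),
    abs_le.mp ((Complex.abs_re_le_norm (E₃ f g σ)).trans hE₃b)]

/-- **`Σ_j 1/λ_j = ∞`** under `PerronHyp` (the zeta function has a genuine pole at `s = 1`): otherwise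
`Σ_j λ_j^{−σ} ≤ Σ_j λ_j^{−1}` would stay bounded as `σ ↓ 1`, against `log(σ/(σ−1)) → ∞`.
[cite: BrouckeVindas2024, proof of Theorem 3.1] -/
theorem PerronHyp.tendsto_sum_inv_prime (h : PerronHyp f g P A K) :
    Tendsto (fun m ↦ ∑ j ∈ Finset.range m, (P.prime j)⁻¹) atTop atTop := by
  have hnn : ∀ j, 0 ≤ (P.prime j)⁻¹ := fun j ↦ (inv_pos.mpr (P.prime_pos j)).le
  rw [← not_summable_iff_tendsto_nat_atTop_of_nonneg hnn]
  intro hS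
  set S : ℝ := ∑' j, (P.prime j)⁻¹ with hSdef
  have hA0 := h.approx.nonneg
  have hK0 := cmpConst_nonneg h.gf
  set M : ℝ := S + 4 * A + 2 * K with hM
  set δ : ℝ := Real.exp (-(M + 1)) with hδ
  have hδ0 : 0 < δ := Real.exp_pos _
  have hS0 : 0 ≤ S := tsum_nonneg hnn
  have hδ1 : δ < 1 := by rw [hδ]; exact Real.exp_lt_one_iff.mpr (by linarith)
  have hσ1 : 1 < 1 + δ := by linarith
  have hσ2 : 1 + δ ≤ 2 := by linarith
  have hlow := h.log_le_tsum_prime_rpow hσ1 hσ2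
  -- `Σ λ^{-(1+δ)} ≤ S`
  have hup : ∑' j, P.prime j ^ (-(1 + δ)) ≤ S := by
    refine (h.approx.summable_prime_rpow_neg h.fb hσ1).tsum_le_tsum (fun j ↦ ?_) hS
    calc P.prime j ^ (-(1 + δ)) ≤ P.prime j ^ (-(1 : ℝ)) :=
          Real.rpow_le_rpow_of_exponent_le (P.one_lt_prime j).le (by linarith)
      _ = (P.prime j)⁻¹ := Real.rpow_neg_one _
  -- `log((1+δ)/δ) ≥ M + 1`
  have hlog : M + 1 ≤ Real.log ((1 + δ) / (1 + δ - 1)) := by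
    rw [show (1 + δ) - 1 = δ by ring]
    have h1 : Real.log (1 / δ) = M + 1 := by rw [one_div, Real.log_inv, hδ, Real.log_exp]; ring
    rw [← h1]
    exact Real.log_le_log (by positivity) (div_le_div_of_nonneg_right (by linarith) hδ0.le)
  linarith

/-! ### Step 3b: the change of `Z(1)` under the surgery -/

/-- The prime-power tail term at `s = 1` as a function of the prime: `φ(r) = −log(1 − r^{−1}) − r^{−1}`, so that
`E₁term Q j 1 = φ(λ_j)`. [cite: BrouckeVindas2024, proof of Theorem 3.1] -/
def phi (r : ℝ) : ℂ := -Complex.log (1 - (r : ℂ) ^ (-(1 : ℂ))) - (r : ℂ) ^ (-(1 : ℂ))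

/-- `E₁term Q j 1 = φ(λ_j)`. [cite: BrouckeVindas2024, proof of Theorem 3.1] -/
theorem E₁term_one (Q : BeurlingPrimes) (j : ℕ) : DMV.Template.E₁term Q j 1 = phi (Q.prime j) := rfl

/-- `φ(r) + r^{−1} = −log(1 − 1/r)`, a real number for `r > 1`. [cite: BrouckeVindas2024, proof of Theorem 3.1] -/
theorem phi_add_inv {r : ℝ} (hr : 1 < r) :
    phi r + (r : ℂ) ^ (-(1 : ℂ)) = ((-Real.log (1 - r⁻¹) : ℝ) : ℂ) := by
  have hr0 : 0 < r := by linarith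
  have h1 : (r : ℂ) ^ (-(1 : ℂ)) = ((r⁻¹ : ℝ) : ℂ) := by
    rw [Complex.cpow_neg_one, Complex.ofReal_inv]
  have hpos : 0 ≤ 1 - r⁻¹ := by
    have := inv_lt_one_of_one_lt₀ hr; linarith
  rw [phi, sub_add_cancel, h1, ← Complex.ofReal_one, ← Complex.ofReal_sub, ← Complex.ofReal_log hpos,
    Complex.ofReal_neg]

/-- **`Z(1)` after the surgery**: for a system `P₀` with (1.3) and the modified system `P = P₀.surgery m q`,
`Z_P(1) − Z_{P₀}(1) = −log(1 − 1/q) − Σ_{j<m} (−log(1 − 1/λ_j))` (the `E₁`-parts change by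
`φ(q) − Σ_{j<m} φ(λ_j)`, the `E₂`-parts by `q^{−1} − Σ_{j<m} λ_j^{−1}`, and `φ(r) + r^{−1} = −log(1 − 1/r)`).
[cite: BrouckeVindas2024, proof of Theorem 3.1] -/
theorem Z_surgery_sub {P₀ : BeurlingPrimes} {A₀ A : ℝ} (h₀ : Approx liDens P₀ A₀) {m : ℕ} {q : ℝ} (hq : 1 < q)
    (hqm : q ≤ P₀.prime m) (h : Approx liDens (P₀.surgery m q hq hqm) A) :
    Z liDens DMV.poleDensity (P₀.surgery m q hq hqm) 1 - Z liDens DMV.poleDensity P₀ 1 =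
      ((-Real.log (1 - q⁻¹) - ∑ j ∈ Finset.range m, -Real.log (1 - (P₀.prime j)⁻¹) : ℝ) : ℂ) := by
  have hone : (1 : ℝ) / 2 < (1 : ℂ).re := by norm_num
  -- `E₁`
  have hsum₀ : Summable fun j ↦ phi (P₀.prime j) := h₀.summable_E₁term abs_liDens_le_two hone
  obtain ⟨-, hE₁P, hE₁P₀⟩ := P₀.tsum_prime_surgery hq hqm phi hsum₀
  have hE₁ : DMV.Template.E₁ (P₀.surgery m q hq hqm) 1 - DMV.Template.E₁ P₀ 1 =
      phi q - ∑ j ∈ Finset.range m, phi (P₀.prime j) := by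
    simp only [DMV.Template.E₁, E₁term_one]
    rw [hE₁P, hE₁P₀]
    ring
  -- `E₂`
  have hint := (integrableOn_err_mul_cpow h measurable_liDens abs_liDens_le_two 0 hone)
  have hint₀ := (integrableOn_err_mul_cpow h₀ measurable_liDens abs_liDens_le_two 0 hone)
  obtain ⟨-, hΔ⟩ := P₀.integral_indexOf_surgery_sub hq hqm (s := 1) (by norm_num)
  have hE₂ : E₂ liDens (P₀.surgery m q hq hqm) 1 - E₂ liDens P₀ 1 =
      ((q : ℝ) : ℂ) ^ (-(1 : ℂ)) - ∑ j ∈ Finset.range m, ((P₀.prime j : ℝ) : ℂ) ^ (-(1 : ℂ)) := by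
    rw [E₂, E₂, one_mul, one_mul, errMellin, errMellin, ← integral_sub hint hint₀]
    rw [div_one] at hΔ
    rw [← hΔ]
    refine setIntegral_congr_fun measurableSet_Ioi fun v _ ↦ ?_
    simp only [err, BeurlingPrimes.primeSum_zero]
    push_cast
    ring
  -- assemble
  have hZ : Z liDens DMV.poleDensity (P₀.surgery m q hq hqm) 1 - Z liDens DMV.poleDensity P₀ 1 =
      (phi q + ((q : ℝ) : ℂ) ^ (-(1 : ℂ))) -
        ∑ j ∈ Finset.range m, (phi (P₀.prime j) + ((P₀.prime j : ℝ) : ℂ) ^ (-(1 : ℂ))) := by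
    rw [Finset.sum_add_distrib]
    calc Z liDens DMV.poleDensity (P₀.surgery m q hq hqm) 1 - Z liDens DMV.poleDensity P₀ 1
        = (DMV.Template.E₁ (P₀.surgery m q hq hqm) 1 - DMV.Template.E₁ P₀ 1) +
            (E₂ liDens (P₀.surgery m q hq hqm) 1 - E₂ liDens P₀ 1) := by
          simp only [Z]; ring
      _ = _ := by rw [hE₁, hE₂]; ring
  rw [hZ, phi_add_inv hq, Finset.sum_congr rfl fun j _ ↦ phi_add_inv (P₀.one_lt_prime j)]
  push_cast
  ring

/-! ### Step 3c: the modified system -/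

/-- (1.3) survives the surgery with constant `A + m + 1` (the exponential sums change by at most `m + 1 ≤ (m+1)·gauge`).
[cite: BrouckeVindas2024, proof of Theorem 3.1] -/
theorem approx_surgery {P₀ : BeurlingPrimes} {A : ℝ} (h₀ : Approx liDens P₀ A) (m : ℕ) {q : ℝ} (hq : 1 < q)
    (hqm : q ≤ P₀.prime m) : Approx liDens (P₀.surgery m q hq hqm) (A + (m + 1)) := by
  intro x hx t
  have h1 := P₀.norm_primeSum_surgery_sub_le hq hqm x t
  have h2 := h₀ x hx t
  have hg : 1 ≤ gauge x t := (Real.one_le_sqrt.mpr hx).trans (sqrt_le_gauge x t)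
  have hm0 : (0 : ℝ) ≤ m + 1 := by positivity
  calc ‖(P₀.surgery m q hq hqm).primeSum x t - tmplSum liDens x t‖
      ≤ ‖(P₀.surgery m q hq hqm).primeSum x t - P₀.primeSum x t‖ + ‖P₀.primeSum x t - tmplSum liDens x t‖ := by
        rw [← sub_add_sub_cancel]; exact norm_add_le _ _
    _ ≤ (m + 1) * 1 + A * gauge x t := by rw [mul_one]; exact add_le_add h1 h2
    _ ≤ (m + 1) * gauge x t + A * gauge x t := by
        refine add_le_add (mul_le_mul_of_nonneg_left hg hm0) le_rfl
    _ = (A + (m + 1)) * gauge x t := by ring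

/-- `π = li + O(1)` survives the surgery. [cite: BrouckeVindas2024, proof of Theorem 3.1] -/
theorem primeCount_surgery_sub_li {P₀ : BeurlingPrimes} {B : ℝ} (hπ : ∀ y : ℝ, |(P₀.primeCount y : ℝ) - li y| ≤ B)
    (m : ℕ) {q : ℝ} (hq : 1 < q) (hqm : q ≤ P₀.prime m) (y : ℝ) :
    |((P₀.surgery m q hq hqm).primeCount y : ℝ) - li y| ≤ B + (m + 1) := by
  have h1 := P₀.abs_indexOf_surgery_sub_le hq hqm y
  have h2 := hπ y
  rw [BeurlingPrimes.primeCount_eq_indexOf] at h2 ⊢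
  calc |(((P₀.surgery m q hq hqm).indexOf y : ℕ) : ℝ) - li y|
      = |((((P₀.surgery m q hq hqm).indexOf y : ℕ) : ℝ) - P₀.indexOf y) + ((P₀.indexOf y : ℝ) - li y)| := by ring_nf
    _ ≤ (m + 1) + B := (abs_add_le _ _).trans (add_le_add h1 h2)
    _ = B + (m + 1) := add_comm _ _

/-! ### The assembly -/

/-- From an eventual bound to the `Ω`-clause of Theorem 3.1: if the primes of `P` are `0`-well-behaved then
`x^{1/2−ε} ≤ |N_P(x) − x|` for arbitrarily large `x` (Hilberdink 2005, Theorem 1, through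
`not_intErrorLE_of_hilberdink`). [cite: BrouckeVindas2024, proof of Theorem 3.1] -/
theorem frequently_of_primes_wellBehaved {P : BeurlingPrimes}
    (hpu : ∀ ε : ℝ, 0 < ε → P.PrimeErrorLE ε) {ε : ℝ} (hε : 0 < ε) :
    ∃ᶠ x : ℝ in atTop, 1 * x ^ (1 / 2 - ε) ≤ |(P.intCount x : ℝ) - x| := by
  set ε' : ℝ := min ε (1 / 4) with hε'
  have hε'0 : 0 < ε' := lt_min hε (by norm_num)
  have hε'le : ε' ≤ ε := min_le_left _ _
  have hε'4 : ε' ≤ 1 / 4 := min_le_right _ _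
  have hnot : ¬ P.IntErrorLE 1 (1 / 2 - ε') :=
    P.not_intErrorLE_of_hilberdink Hilberdink2005_thm1_holds (α := 0) (a := 1) le_rfl (by norm_num) one_pos
      (fun e he ↦ by rw [zero_add]; exact hpu e he) (fun e he ↦ P.not_primeErrorLE_of_neg (by linarith)) hε'0
  by_contra hfreq
  apply hnot
  rw [Filter.not_frequently] at hfreq
  obtain ⟨X, hX⟩ := (hfreq.and (eventually_ge_atTop (1 : ℝ))).exists_forall_of_atTop
  refine P.intErrorLE_of_forall_ge (γ := 1 / 2 - ε') (by linarith) (X := X) (C := 1) fun x hx ↦ ?_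
  obtain ⟨h1, hx1⟩ := hX x hx
  simp only [one_mul] at h1 ⊢
  have h2 : |(P.intCount x : ℝ) - x| < x ^ (1 / 2 - ε) := not_le.mp h1
  exact h2.le.trans (Real.rpow_le_rpow_of_exponent_le hx1 (by linarith))

/-- **Broucke–Vindas 2024, Theorem 3.1 from Theorem 1.2.** [cite: BrouckeVindas2024, Theorem 3.1] -/
theorem _root_.Literature.NumberTheory.BeurlingPrimes.BrouckeVindas2024_thm31_of_thm12 (h12 : BrouckeVindas2024_thm12) :
    BrouckeVindas2024_thm31 := by
  -- Step 1: Theorem 1.2 for `F = li`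
  obtain ⟨⟨P₀, hπ₀, A₀, hA₀⟩, -⟩ := h12 liStieltjes liStieltjes_one liStieltjes_nonneg tendsto_liStieltjes_atTop
    liStieltjes_chebyshev
  have hApprox₀ : Approx liDens P₀ A₀ := by
    intro x hx t
    have h := hA₀ t x hx
    rwa [stieltjesExpSum_liStieltjes hx t] at h
  have hπ₀' : ∀ y : ℝ, |(P₀.primeCount y : ℝ) - li y| ≤ 2 := fun y ↦ by
    have := hπ₀ y; rwa [liStieltjes_apply] at this
  -- Step 2–3: `Σ 1/λ_j = ∞`, and the surgery making `Re Z(1) = 0`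
  have hP₀ := perronHyp_li hApprox₀
  obtain ⟨m, q, hq, hqm, hshift⟩ := P₀.exists_surgery_shift hP₀.tendsto_sum_inv_prime
    (-(Z liDens DMV.poleDensity P₀ 1).re)
  have hApprox : Approx liDens (P₀.surgery m q hq hqm) (A₀ + (m + 1)) := approx_surgery hApprox₀ m hq hqm
  have hP := perronHyp_li hApprox
  have hπ : ∀ y : ℝ, 1 ≤ y → |((P₀.surgery m q hq hqm).primeCount y : ℝ) - li y| ≤ 2 + (m + 1) := fun y _ ↦
    primeCount_surgery_sub_li hπ₀' m hq hqm y
  -- the residue of the new system is `1`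
  have hZ1 : Z liDens DMV.poleDensity (P₀.surgery m q hq hqm) 1 = ((Z liDens DMV.poleDensity P₀ 1).im : ℂ) * I := by
    have hd := Z_surgery_sub hApprox₀ hq hqm hApprox
    rw [hshift] at hd
    have : Z liDens DMV.poleDensity (P₀.surgery m q hq hqm) 1 =
        Z liDens DMV.poleDensity P₀ 1 + ((-(Z liDens DMV.poleDensity P₀ 1).re : ℝ) : ℂ) := by
      rw [← hd]; ring
    rw [this]
    apply Complex.ext <;> simp
  have hres : (res liDens DMV.poleDensity (P₀.surgery m q hq hqm)).re = 1 := by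
    obtain ⟨-, hre⟩ := hP.res_real_pos
    have hnorm : ‖res liDens DMV.poleDensity (P₀.surgery m q hq hqm)‖ = 1 := by
      rw [res, hZ1, Complex.norm_exp_ofReal_mul_I]
    have h2 : ‖res liDens DMV.poleDensity (P₀.surgery m q hq hqm)‖ =
        |(res liDens DMV.poleDensity (P₀.surgery m q hq hqm)).re| := by
      conv_lhs => rw [hP.res_eq_ofReal]
      rw [Complex.norm_real, Real.norm_eq_abs]
    rw [h2, abs_of_pos hre] at hnorm
    exact hnorm
  refine ⟨P₀.surgery m q hq hqm, ?_, ?_, ?_⟩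
  · -- (a) `Π_P = Li + O(log log x)`
    exact exists_abs_riemannPrimeCount_sub_Li_le _ hπ
  · -- (b) `N_P = x + O(x^{1/2} exp(c (log x)^{2/3}))`
    have hc0 : 0 < cexpo (CZ (P₀.surgery m q hq hqm) (A₀ + (m + 1)) 1) := by
      have := hP.CZ_nonneg; unfold cexpo; positivity
    have hX₀2 : (2 : ℝ) ≤ Real.exp 64 := by have := Real.add_one_le_exp (64:ℝ); linarith
    have hB0 : (0 : ℝ) ≤ ((P₀.surgery m q hq hqm).intCount (Real.exp 64) : ℝ) + Real.exp 64 := by positivity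
    refine ⟨cexpo (CZ (P₀.surgery m q hq hqm) (A₀ + (m + 1)) 1),
      (1 / 2 + 128) + (((P₀.surgery m q hq hqm).intCount (Real.exp 64) : ℝ) + Real.exp 64), hc0, fun x hx ↦ ?_⟩
    have hx1 : 1 ≤ x := by linarith
    have hG1 : 1 ≤ x ^ (1 / 2 : ℝ) *
        Real.exp (cexpo (CZ (P₀.surgery m q hq hqm) (A₀ + (m + 1)) 1) * Real.log x ^ (2 / 3 : ℝ)) := by
      have h1 : 1 ≤ x ^ (1 / 2 : ℝ) := Real.one_le_rpow hx1 (by norm_num)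
      have h2 : 1 ≤ Real.exp (cexpo (CZ (P₀.surgery m q hq hqm) (A₀ + (m + 1)) 1) * Real.log x ^ (2 / 3 : ℝ)) :=
        Real.one_le_exp (mul_nonneg hc0.le (Real.rpow_nonneg (Real.log_nonneg hx1) _))
      nlinarith
    rcases le_or_gt (Real.exp 64) x with hxX | hxX
    · have h := hP.abs_intCount_sub_le hxX
      rw [hres, one_mul] at h
      refine h.trans ?_
      nlinarith
    · -- small `x`: `|N(x) − x| ≤ N(X₀) + X₀ = B ≤ B · gauge`
      have hN : ((P₀.surgery m q hq hqm).intCount x : ℝ) ≤ (P₀.surgery m q hq hqm).intCount (Real.exp 64) := by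
        exact_mod_cast (P₀.surgery m q hq hqm).intCount_mono hxX.le
      have hN0 : (0 : ℝ) ≤ (P₀.surgery m q hq hqm).intCount x := Nat.cast_nonneg _
      have h1 : |((P₀.surgery m q hq hqm).intCount x : ℝ) - x| ≤
          ((P₀.surgery m q hq hqm).intCount (Real.exp 64) : ℝ) + Real.exp 64 := by
        rw [abs_le]; constructor <;> linarith
      nlinarith
  · -- (c) `N_P − x = Ω_ε(x^{1/2−ε})` via Hilberdink's theorem
    intro ε hε
    obtain ⟨C, hC⟩ := exists_abs_riemannPrimeCount_sub_Li_le _ hπ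
    refine ⟨1, one_pos, ?_⟩
    exact frequently_of_primes_wellBehaved
      (fun e he ↦ (P₀.surgery m q hq hqm).primeErrorLE_of_riemannPrimeCount_sub_Li hC he) hε

end BV

end Literature.NumberTheory.BeurlingPrimes
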